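import Literature.NumberTheory.EllipticCurves.HeegnerGeomCoherentDataProofs
import Literature.NumberTheory.EllipticCurves.HeegnerTraceRelationSplitProofs
import HarnessLib

/-!
# The coherent Heegner data of a (light) Heegner FRAME, assembled (CGLS 2022 Thm. 4.1.1 proof / Rem. 4.1.4;
# Howard 2004 §3.3; Perrin-Riou 1987 §3) — THEOREMS ONLY

Topic `NumberTheory/EllipticCurves`; namespace `Literature.NumberTheory.EllipticCurves`. No definition, no
named fact. Cell `pub/bsd-print-x9`, LEAD `bsd-line-x9-p1` (envelope infrastructure, part VI-d: the FRAME-SIDE glue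
for the registered stub `stub_envelopeModulesSharp` of the line `torsion-depth-pinned` on
`PrintX9.HowardContainmentLightFramePinnedOfPrintSharp` and its X10b twin).

From the binders of a rank-one Heegner frame as the routes state them — `K` imaginary quadratic with `d_K` odd and
`d_K ≠ −3`, the Heegner hypothesis for `N = N_E` and for `p` (i.e. `p` split), an odd good prime `p ∤ N`, a
`ℤ_p`-extension `κ` with `K_k ⊆ K[p^{k+1}]` (the route item `AnticyclotomicTowerSharp`), a parametrisation datum
`Dt` and a Heegner datum `H` (orientation `H.β`), an embedding `jbar : K̄ → ℂ` — this file produces in ONE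
existential the whole coherent package the envelope provers consume:

* `discr_lt_neg_four_of_odd` — `d_K < −4` (Stickelberger/Minkowski `|d_K| > 2`, oddness, `d_K ≠ −3`), hence
  `𝒪_K^× = {±1}`;
* `card_ringClassGalOver_prime_one_of_frame` — `[K[p] : K[1]] = p − 1` (`hcardp`) at a split `p` with `d_K < −4`
  (Darmon Prop. 3.10 proof / Cox Cor. 7.28: `HeegnerTraceSplit.card_ringClassGalOver_eq_of_split` at `m = 1`);
* `exists_coherentHeegnerData_of_frame` — the principal system `x_c` of Heegner points of conductors `p^c` with
  models `P_c ∈ E(K[p^c])` (`exists_principalSystem`), Howard's family `F` ON it (`y = Σ_T t • x_0`,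
  `z_j = Σ_{R_j} r • x_{j+1}`; `exists_heegnerFamily_of_system`) and the `d(k)`-shifted CGLS datum `C` ON it
  (`u_k = Σ_{A_k} a • x_{d(k)}`, `v_k = Σ_{A_k} a • x_{d(k)−1}`, `d(k) ≤ k + 1`, `d(k) ≥ 2` above the depth;
  `exists_stabilizedHeegnerData_of_system`), both with `Dt` and `H.β`, together with all transversals — exactly the
  hypotheses of the point identities (P1)/(P2)/(P3) (`HeegnerGeomCoherentPointIdentitiesProofs`,
  `HeegnerGeomCoherentFamilyIdentityProofs`, `HeegnerGeomStabilizedPointIdentitiesProofs`,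
  `HeegnerGeomLayerDescentProofs`) and of the Kummer descent (`HeegnerEnvelopeDescentProofs`).

## References

* [CastellaGrossiLeeSkinner2022] F. Castella, G. Grossi, J. Lee, C. Skinner, Invent. Math. 227 (2022), Thm. 4.1.1
  (proof: `d(k)`, `P_k[n]`) and Rem. 4.1.4 (arXiv:2008.02571v2, p. 22).
* [Howard2004HeegnerKolyvagin] B. Howard, Compos. Math. 140 (2004), §2.7, §3.3.
* [PerrinRiou1987BSMF] B. Perrin-Riou, Bull. SMF 115 (1987), §1, §3.1–3.4.
* [Darmon2004] H. Darmon, *Rational points on modular elliptic curves*, CBMS 101 (2004), Prop. 3.10.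
* [Cox2013] D. A. Cox, *Primes of the form x² + ny²*, 2nd ed. (2013), Thm. 7.24, Cor. 7.28.
-/

set_option autoImplicit false

noncomputable section

open scoped Classical

namespace Literature.NumberTheory.EllipticCurves

open WeierstrassCurve RingClassField ModularForms

variable {K : Type} [Field K] [NumberField K]

/-- **`d_K < −4` for an imaginary quadratic field of ODD discriminant `≠ −3`** (`|d_K| > 2` by Minkowski,
Mathlib `NumberField.abs_discr_gt_two`; so `d_K ≤ −5`): the frame's `K` has `𝒪_K^× = {±1}`.
[cite: Cox2013, Thm. 7.24 (the unit index in the class number formula for orders)] -/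
theorem IsImaginaryQuadratic.discr_lt_neg_four_of_odd (hK : IsImaginaryQuadratic K)
    (hodd : Odd (NumberField.discr K)) (h3 : NumberField.discr K ≠ -3) : NumberField.discr K < -4 := by
  have hgt : 2 < |NumberField.discr K| := NumberField.abs_discr_gt_two (by rw [hK.1]; exact one_lt_two)
  have hneg : NumberField.discr K < 0 := hK.discr_neg
  rw [abs_of_neg hneg] at hgt
  obtain ⟨r, hr⟩ := hodd
  omega

/-- **`[K[p] : K[1]] = p − 1` at a split prime of a frame** (`p` split in `K`, `d_K` odd, `d_K ≠ −3`): the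
hypothesis `hcardp` of the coherent constructor `exists_stabilizedHeegnerData_of_system` and of the point
identities. [cite: Darmon2004, Prop. 3.10 (proof, p. 36: #Gal(H_{nℓ}/H_n) = ℓ − 1 at a split ℓ)]
[cite: Cox2013, §7.D Cor. 7.28] -/
theorem card_ringClassGalOver_prime_one_of_frame (hK : IsImaginaryQuadratic K) (hodd : Odd (NumberField.discr K))
    (h3 : NumberField.discr K ≠ -3) {p : ℕ} (hp : p.Prime) (hHp : SatisfiesHeegnerHypothesis p K)
    (jbar : AlgebraicClosure K →+* ℂ) :
    Nat.card (ringClassGalOver (jbar.comp (algebraMap K (AlgebraicClosure K))) p 1) = p - 1 := by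
  have hsplit : ((Ideal.span {(p : ℤ)}).primesOver (NumberField.RingOfIntegers K)).ncard = 2 := hHp p hp dvd_rfl
  have h := HeegnerTraceSplit.card_ringClassGalOver_eq_of_split hK (jbar.comp (algebraMap K (AlgebraicClosure K)))
    (m := 1) hp hsplit hp.not_dvd_one one_ne_zero (Or.inr (hK.discr_lt_neg_four_of_odd hodd h3))
  rw [mul_one] at h
  exact h

/-- **The coherent Heegner data of a frame, in one package** (CGLS 2022 Thm. 4.1.1 proof / Rem. 4.1.4; Howard 2004
§3.3; Perrin-Riou 1987 §3): for `E = W/ℚ` at its own level `N = N_E`, `K` imaginary quadratic with `d_K` odd,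
`d_K ≠ −3`, the Heegner hypothesis for `N`, a prime `p ∤ N`, a `ℤ_p`-extension `κ` with `K_k ⊆ K[p^{k+1}]` for all
`k`, a parametrisation datum `Dt`, a Heegner datum `H` and `jbar : K̄ → ℂ` — a principal system `x_c ∈ E(K̄)` of
Heegner points of conductors `p^c` (complex points `φ(x_{H.β}(p^c))`, models `P_c ∈ E(K[p^c])`, each fixed by
`Gal(K̄/K[p^c])`), Howard's family `F` and the `d(k)`-shifted datum `C` ON that system, both with
`(Dt, H.β)`, their transversal presentations (`y = Σ_T t • x_0`, `z_j = Σ_{R_j} r • x_{j+1}`,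
`u_k = Σ_{A_k} a • x_{d(k)}`, `v_k = Σ_{A_k} a • x_{d(k)−1}`), and the shift bounds `d(k) ≤ k + 1`, `d(k) ≥ 2` for
`k > δ` (the latter needs `[K[p] : K[1]] = p − 1`: `p` split, `card_ringClassGalOver_prime_one_of_frame`).
[cite: CastellaGrossiLeeSkinner2022, Thm. 4.1.1 proof (d(k), P_k[n]; arXiv:2008.02571v2 p. 22) and Rem. 4.1.4]
[cite: Howard2004HeegnerKolyvagin, §2.7 (P[m] ∈ E(K[m])) and §3.3 (H_k)] [cite: PerrinRiou1987BSMF, §1 and §3.4] -/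
theorem exists_coherentHeegnerData_of_frame {W : WeierstrassCurve ℚ} [W.IsElliptic] [NeZero (W.conductorNorm ℤ)]
    (hK : IsImaginaryQuadratic K) (hodd : Odd (NumberField.discr K)) (h3 : NumberField.discr K ≠ -3)
    (hHN : SatisfiesHeegnerHypothesis (W.conductorNorm ℤ) K) {p : ℕ} [Fact p.Prime]
    (hHp : SatisfiesHeegnerHypothesis p K) (hpN : ¬ p ∣ W.conductorNorm ℤ) (κ : ZpExtension K p)
    (jbar : AlgebraicClosure K →+* ℂ) (Dt : ModularParametrizationData W (W.conductorNorm ℤ))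
    (H : HeegnerDatum (W.conductorNorm ℤ) (NumberField.discr K))
    (hTw1 : ∀ k, ringClassSubgroup K (p ^ (k + 1)) jbar ≤ κ.layerSubgroup k) :
    ∃ (x : ℕ → WeierstrassCurve.geomPoints (W.baseChange K))
      (P : ∀ c : ℕ,
        (W.baseChange (ringClassField K (jbar.comp (algebraMap K (AlgebraicClosure K))) (p ^ c))).toAffine.Point)
      (F : HeegnerFamily (W.conductorNorm ℤ) W K κ jbar)
      (C : CastellaGrossiLeeSkinner2022.StabilizedHeegnerData (W.conductorNorm ℤ) W K κ jbar)
      (T : Finset (Field.absoluteGaloisGroup K)) (R A : ℕ → Finset (Field.absoluteGaloisGroup K)),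
      (∀ c, complexPoint W jbar (x c) = heegnerPointComplexOfConductor Dt (NumberField.discr K) H.β (p ^ c) ∧
        WeierstrassCurve.Affine.Point.map (W' := W)
          (ringClassField K (jbar.comp (algebraMap K (AlgebraicClosure K))) (p ^ c)).subtype.toRatAlgHom (P c) =
          heegnerPointComplexOfConductor Dt (NumberField.discr K) H.β (p ^ c) ∧
        IsHeegnerGeomPoint (W.conductorNorm ℤ) W K Dt H.β (p ^ c) jbar (x c) ∧
        ∀ σ ∈ ringClassSubgroup K (p ^ c) jbar, σ • x c = x c) ∧
      (F.Dt = Dt ∧ F.β = H.β ∧ C.Dt = Dt ∧ C.β = H.β) ∧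
      ((∀ t ∈ T, t ∈ κ.layerSubgroup 0) ∧
        (∀ τ ∈ κ.layerSubgroup 0, ∃! t, t ∈ T ∧ t⁻¹ * τ ∈ ringClassSubgroup K 1 jbar) ∧
        F.y = ∑ t ∈ T, t • x 0) ∧
      (∀ j, ((∀ r ∈ R j, r ∈ κ.layerSubgroup j) ∧
        ∀ τ ∈ κ.layerSubgroup j, ∃! r, r ∈ R j ∧ r⁻¹ * τ ∈ ringClassSubgroup K (p ^ (j + 1)) jbar) ∧
        F.z j = ∑ r ∈ R j, r • x (j + 1)) ∧
      (∀ k, C.d k ≤ k + 1) ∧ (∀ k, C.depth < k → 2 ≤ C.d k) ∧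
      (∀ k, ((∀ a ∈ A k, a ∈ κ.layerSubgroup k) ∧
        ∀ τ ∈ κ.layerSubgroup k, ∃! a, a ∈ A k ∧ a⁻¹ * τ ∈ ringClassSubgroup K (p ^ C.d k) jbar) ∧
        C.u k = ∑ a ∈ A k, a • x (C.d k) ∧ C.v k = ∑ a ∈ A k, a • x (C.d k - 1)) := by
  have hp : p.Prime := Fact.out
  obtain ⟨x, P, hx⟩ := exists_principalSystem (N := W.conductorNorm ℤ) hK hHN Dt H.dvd_sq_sub jbar hp hpN
  have hgeom : ∀ j, IsHeegnerGeomPoint (W.conductorNorm ℤ) W K Dt H.β (p ^ j) jbar (x j) := fun j ↦ (hx j).2.2.1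
  have hfix : ∀ j, ∀ σ ∈ ringClassSubgroup K (p ^ j) jbar, σ • x j = x j := fun j ↦ (hx j).2.2.2
  obtain ⟨F, T, R, hFDt, hFβ, hT, hy, hR, hz⟩ :=
    exists_heegnerFamily_of_system (N := W.conductorNorm ℤ) Dt H.dvd_sq_sub jbar κ hgeom hfix
  obtain ⟨C, A, hCDt, hCβ, hdle, htwo, hA, hu, hv⟩ :=
    exists_stabilizedHeegnerData_of_system (N := W.conductorNorm ℤ) hK Dt H.dvd_sq_sub jbar κ hTw1
      (card_ringClassGalOver_prime_one_of_frame hK hodd h3 hp hHp jbar) hgeom hfix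
  exact ⟨x, P, F, C, T, R, A, hx, ⟨hFDt, hFβ, hCDt, hCβ⟩, ⟨hT.1, hT.2, hy⟩,
    fun j ↦ ⟨hR j, hz j⟩, hdle, htwo, fun k ↦ ⟨hA k, hu k, hv k⟩⟩

end Literature.NumberTheory.EllipticCurves

end
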